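import Summits.QuantumFields.QCD.Theses.QuarksAsStableAction
import Summits.QuantumFields.QCD.Theses.WilsonQuarkChessboard
import Literature.MathematicalPhysics.QuantumLattice.WilsonDiracAP
import Literature.Probability.LatticeModels.TorusFourierProofs

/-!
# Stub `stub_transferEven` of line `Sketch` (idea `free-tangent-landau-chessboard`)
(crux `Summit.QuantumFields.QCD.Theses.QuarksAsStableAction.WilsonQuarkStability`, item stmt-QuantumFields-9736,
route route-QuantumFields-QuarksAsStableAction)

Transfer through the quark chessboard to EVEN tori.  Hypothesis 1 (`TilingStability`, the card's
C⁺) bounds the antiperiodic Wilson determinant of every period-2 reflection tiling `tile_c V` of a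
`U(3)` field by `exp(C L⁴ s_c(V)) · ‖det_AP 1‖`, `s_c` the sum of the plaquette deficits of the
closed unit cell at `c`.  Hypothesis 2 is the quark chessboard of the sibling route
(`WilsonQuarkChessboard.QuarkChessboard`, item stmt-QuantumFields-9306, an OPEN crux taken as a
hypothesis): for even `L ≥ 4`, `m > -1` and every `U(3)` field,
`0 ≤ Re det_AP[tile_c V]` and `‖det_AP V‖^(L⁴) ≤ Π_c Re det_AP[tile_c V]`.  Conclusion: the crux
`QuarksAsStableAction.WilsonQuarkStability` verbatim with `Even L →` inserted.

Proof.  (a) The chessboard's seam `(e.1 e.2).val + 1 = L` is the tree's `e.1 e.2 = -1`, so its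
`det_AP W` is `det D[apTwistAt (fun _ => -1) W]`; (b) the crux's `apDet U m` is by `rfl` the same
determinant of the plain lift `unitaryLift U`, and `unitaryLift 1 = 1`; (c) the `U(3)` and `SU(3)`
plaquette deficits agree; (d) `Re z ≤ ‖z‖`, products of non-negative factors and
`Π_c exp(C L⁴ s_c) F = (exp(C Σ_c s_c) F)^(L⁴)` (`|Site 4 L| = L⁴`), then `L⁴`-th roots;
(e) double counting `Σ_c s_c ≤ 16 Σ_p deficit(p)` (a plaquette at `x` lies in the cell of `c` only
if `x - c ∈ {0,1}⁴`); (f) deficits lie in `[0, 6]`, so splitting at `δ = 1` gives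
`16 C S ≤ 16 C S_good + 96 C N_bad`.  Output constants: `ε' = min ε (1/2)`, `δ = 1`, `K = 0`,
`c₂ = 16 C`, `C_bad = 96 C`, `L₀' = max L₀ 4`.  Pure theorem file (no `def`s).
-/

namespace Summit.QuantumFields.QCD.Cruxes.WilsonQuarkStability.FreeTangentLandauChessboard

open Literature.MathematicalPhysics Literature.MathematicalPhysics.QuantumLattice
  Literature.MathematicalPhysics.QuantumFieldTheory Literature.Probability.LatticeModels
open Matrix Complex
open scoped Kronecker ComplexOrder ComplexConjugate BigOperators

noncomputable section

/-! ## Elementary lemmas -/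

/-- Seam convention: on `ZMod L` (`L ≠ 0`), `x.val + 1 = L ↔ x = -1`. -/
private theorem val_add_one_eq_iff {L : ℕ} [NeZero L] (x : ZMod L) :
    x.val + 1 = L ↔ x = -1 := by
  obtain ⟨n, hn⟩ : ∃ n, L = n + 1 := Nat.exists_eq_succ_of_ne_zero (NeZero.ne L)
  subst hn
  constructor
  · intro h
    have h1 : ((x.val + 1 : ℕ) : ZMod (n + 1)) = 0 := by
      rw [h]
      exact ZMod.natCast_self _
    rw [Nat.cast_add, Nat.cast_one, ZMod.natCast_zmod_val] at h1
    exact eq_neg_of_add_eq_zero_left h1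
  · rintro rfl
    rw [ZMod.val_neg_one]

/-- The chessboard's seam twist is the tree's `apTwistAt (fun _ => -1)`. -/
private theorem seam_eq_apTwistAt {L N : ℕ} [NeZero L]
    (W : GaugeConfig 4 L (Matrix.unitaryGroup (Fin N) ℂ)) :
    (fun e : Edge 4 L => if (e.1 e.2).val + 1 = L then -W e else W e) =
      apTwistAt (fun _ => (-1 : ZMod L)) W := by
  funext e
  rw [apTwistAt_apply]
  by_cases h : e.1 e.2 = -1
  · rw [if_pos ((val_add_one_eq_iff _).2 h), if_pos h]
  · rw [if_neg (fun h' => h ((val_add_one_eq_iff _).1 h')), if_neg h]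

/-- The plain lift of the trivial field is trivial. -/
private theorem unitaryLift_one {d L N : ℕ} :
    unitaryLift (1 : GaugeConfig d L (Matrix.specialUnitaryGroup (Fin N) ℂ)) = 1 :=
  funext fun _ => Subtype.ext rfl

/-- The plaquette holonomies of the `U(N)` lift are those of the `SU(N)` field. -/
private theorem coe_plaquetteHolonomy_unitaryLift {d L N : ℕ}
    (U : GaugeConfig d L (Matrix.specialUnitaryGroup (Fin N) ℂ)) (x : Site d L) (i j : Fin d) :
    ((plaquetteHolonomy (unitaryLift U) x i j : Matrix.unitaryGroup (Fin N) ℂ) :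
        Matrix (Fin N) (Fin N) ℂ) = fundamentalRep (Fin N) (plaquetteHolonomy U x i j) := by
  have h : plaquetteHolonomy (unitaryLift U) x i j =
      suInclusion (N := N) (plaquetteHolonomy U x i j) := by
    simp only [plaquetteHolonomy, map_mul, map_inv, unitaryLift_apply]
  rw [h, fundamentalRep_apply]
  rfl

/-- `SU(3)` plaquette deficits lie in `[0, 6]`. -/
private theorem deficit_bounds {d L : ℕ}
    (U : GaugeConfig d L (Matrix.specialUnitaryGroup (Fin 3) ℂ)) (p : Plaquette d L) :
    0 ≤ 3 - (fundamentalRep (Fin 3) (plaquetteHolonomy U p.1 p.2.1.1 p.2.1.2)).trace.re ∧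
      3 - (fundamentalRep (Fin 3) (plaquetteHolonomy U p.1 p.2.1.1 p.2.1.2)).trace.re ≤ 6 := by
  have hρ : ∀ g : Matrix.specialUnitaryGroup (Fin 3) ℂ,
      fundamentalRep (Fin 3) g ∈ Matrix.unitaryGroup (Fin 3) ℂ :=
    fun g => Matrix.specialUnitaryGroup_le_unitaryGroup g.2
  have h0 := plaquetteDeficit_nonneg (fundamentalRep (Fin 3)) hρ U p
  have h6 := plaquetteDeficit_le (fundamentalRep (Fin 3)) hρ U p
  simp only [plaquetteDeficit, Nat.cast_ofNat] at h0 h6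
  exact ⟨h0, by linarith⟩

/-- A plaquette based at `x` lies in the unit cell of at most `16` corners `c`. -/
private theorem card_cells_le {L : ℕ} [NeZero L] (x : Site 4 L) :
    (Finset.univ.filter fun c : Site 4 L => ∀ ν, (x ν - c ν).val ≤ 1).card ≤ 16 := by
  have h := Finset.card_le_card_of_injOn
    (s := Finset.univ.filter fun c : Site 4 L => ∀ ν, (x ν - c ν).val ≤ 1)
    (t := Fintype.piFinset fun _ : Fin 4 => Finset.range 2)
    (fun (c : Site 4 L) (ν : Fin 4) => (x ν - c ν).val) ?_ ?_
  · simpa using h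
  · intro c hc
    have hc' := (Finset.mem_filter.1 (Finset.mem_coe.1 hc)).2
    rw [Finset.mem_coe, Fintype.mem_piFinset]
    intro ν
    have := hc' ν
    show (x ν - c ν).val ∈ Finset.range 2
    exact Finset.mem_range.2 (by omega)
  · intro c _ c' _ hcc
    funext ν
    have h1 : (x ν - c ν).val = (x ν - c' ν).val := congr_fun hcc ν
    exact sub_right_injective (ZMod.val_injective L h1)

/-- Double counting: the cell sums add up to at most `16` Wilson actions. -/
private theorem sum_cells_le {L : ℕ} [NeZero L] (f : Plaquette 4 L → ℝ) (hf : ∀ p, 0 ≤ f p) :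
    ∑ c : Site 4 L, ∑ p ∈ Finset.univ.filter (fun p : Plaquette 4 L =>
        (∀ ν, (p.1 ν - c ν).val ≤ 1) ∧ (p.1 p.2.1.1 - c p.2.1.1).val = 0 ∧
          (p.1 p.2.1.2 - c p.2.1.2).val = 0), f p ≤ 16 * ∑ p, f p := by
  calc ∑ c : Site 4 L, ∑ p ∈ Finset.univ.filter (fun p : Plaquette 4 L =>
        (∀ ν, (p.1 ν - c ν).val ≤ 1) ∧ (p.1 p.2.1.1 - c p.2.1.1).val = 0 ∧
          (p.1 p.2.1.2 - c p.2.1.2).val = 0), f p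
      ≤ ∑ c : Site 4 L, ∑ p ∈ Finset.univ.filter
          (fun p : Plaquette 4 L => ∀ ν, (p.1 ν - c ν).val ≤ 1), f p := by
        refine Finset.sum_le_sum fun c _ => Finset.sum_le_sum_of_subset_of_nonneg
          (fun p hp => ?_) fun p _ _ => hf p
        simp only [Finset.mem_filter, Finset.mem_univ, true_and] at hp ⊢
        exact hp.1
    _ = ∑ p : Plaquette 4 L, ∑ c ∈ Finset.univ.filter
          (fun c : Site 4 L => ∀ ν, (p.1 ν - c ν).val ≤ 1), f p := by
        simp only [Finset.sum_filter]
        exact Finset.sum_comm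
    _ ≤ ∑ p : Plaquette 4 L, 16 * f p := by
        refine Finset.sum_le_sum fun p _ => ?_
        rw [Finset.sum_const, nsmul_eq_mul]
        exact mul_le_mul_of_nonneg_right (by exact_mod_cast card_cells_le p.1) (hf p)
    _ = 16 * ∑ p, f p := by rw [Finset.mul_sum]

/-- Splitting the Wilson action at `δ = 1` with deficits in `[0, 6]`. -/
private theorem split_le {ι : Type*} (s : Finset ι) (f : ι → ℝ) (hf0 : ∀ p, 0 ≤ f p)
    (hf6 : ∀ p, f p ≤ 6) {C : ℝ} (hC : 0 ≤ C) :
    C * (16 * ∑ p ∈ s, f p) ≤ 0 + 16 * C * (∑ p ∈ s.filter (fun p => f p < 1), f p) +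
      96 * C * ((s.filter fun p => 1 ≤ f p).card : ℝ) := by
  classical
  have hsplit : ∑ p ∈ s, f p =
      (∑ p ∈ s.filter (fun p => f p < 1), f p) + ∑ p ∈ s.filter (fun p => 1 ≤ f p), f p := by
    rw [← Finset.sum_filter_add_sum_filter_not s (fun p => f p < 1)]
    congr 1
    refine Finset.sum_congr ?_ fun _ _ => rfl
    ext p
    simp [not_lt]
  have hbad : ∑ p ∈ s.filter (fun p => 1 ≤ f p), f p ≤
      6 * ((s.filter fun p => 1 ≤ f p).card : ℝ) := by
    calc ∑ p ∈ s.filter (fun p => 1 ≤ f p), f p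
        ≤ ∑ _p ∈ s.filter (fun p => 1 ≤ f p), (6 : ℝ) := Finset.sum_le_sum fun p _ => hf6 p
      _ = _ := by rw [Finset.sum_const, nsmul_eq_mul, mul_comm]
  have hgood : 0 ≤ ∑ p ∈ s.filter (fun p => f p < 1), f p :=
    Finset.sum_nonneg fun p _ => hf0 p
  have h1 := mul_le_mul_of_nonneg_left hbad hC
  have h2 := mul_nonneg hC hgood
  rw [hsplit]
  nlinarith [h1, h2]

/-- Abstract combination of the chessboard with the per-cell stability bound:
`‖z‖^n ≤ Π_c Re w_c`, `Re w_c ≤ ‖w_c‖ ≤ exp(C n s_c) F` give `‖z‖ ≤ exp(C Σ_c s_c) F`. -/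
private theorem combine {ι : Type*} [Fintype ι] {n : ℕ} (hn : Fintype.card ι = n) (hn0 : n ≠ 0)
    {N : ℝ} (hN : ((n : ℕ) : ℝ) = N) {F : ℝ} (hF : 0 ≤ F) {z : ℂ} {w : ι → ℂ} {s : ι → ℝ}
    {C : ℝ} (hre : ∀ c, 0 ≤ (w c).re) (hpow : ‖z‖ ^ n ≤ ∏ c, (w c).re)
    (hT : ∀ c, ‖w c‖ ≤ Real.exp (C * N * s c) * F) :
    ‖z‖ ≤ Real.exp (C * ∑ c, s c) * F := by
  have h1 : ∏ c, (w c).re ≤ ∏ c, (Real.exp (C * N * s c) * F) :=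
    Finset.prod_le_prod (fun c _ => hre c) fun c _ => (Complex.re_le_norm _).trans (hT c)
  have h2 : ∏ c, (Real.exp (C * N * s c) * F) = (Real.exp (C * ∑ c, s c) * F) ^ n := by
    rw [Finset.prod_mul_distrib, Finset.prod_const, Finset.card_univ, hn, mul_pow,
      ← Real.exp_sum, ← Real.exp_nat_mul, hN, Finset.mul_sum, Finset.mul_sum]
    congr 2
    exact Finset.sum_congr rfl fun c _ => by ring
  exact le_of_pow_le_pow_left₀ hn0 (mul_nonneg (Real.exp_nonneg _) hF)
    ((hpow.trans h1).trans h2.le)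

/-- The quark chessboard (item stmt-QuantumFields-9306, `N := 3`) in the tree's seam convention:
its `dAP` is `det D[apTwistAt (fun _ => -1) ·]`. -/
private theorem qc_apTwistAt
    (hQC : Summit.QuantumFields.QCD.Theses.WilsonQuarkChessboard.QuarkChessboard)
    {L : ℕ} [NeZero L] (hEv : Even L) (h4 : 4 ≤ L)
    (V : GaugeConfig 4 L (Matrix.unitaryGroup (Fin 3) ℂ)) {m : ℝ} (hm : -1 < m) :
    let dAP : GaugeConfig 4 L (Matrix.unitaryGroup (Fin 3) ℂ) → ℂ := fun W =>
      (wilsonDirac (unitaryFundamentalRep (Fin 3) ℂ) (apTwistAt (fun _ => (-1 : ZMod L)) W) m 1).det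
    let tile : Site 4 L → GaugeConfig 4 L (Matrix.unitaryGroup (Fin 3) ℂ) →
        GaugeConfig 4 L (Matrix.unitaryGroup (Fin 3) ℂ) := fun c V e =>
      if (e.1 e.2 - c e.2).val % 2 = 0
        then V (fun ν => c ν + (((e.1 ν - c ν).val % 2 : ℕ) : ZMod L), e.2)
        else (V (fun ν => c ν + (((Site.shift e.1 e.2 ν - c ν).val % 2 : ℕ) : ZMod L), e.2))⁻¹
    (∀ c, 0 ≤ (dAP (tile c V)).re ∧ (dAP (tile c V)).im = 0) ∧
      ‖dAP V‖ ^ (L ^ 4) ≤ ∏ c : Site 4 L, (dAP (tile c V)).re := by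
  have key : (fun W : GaugeConfig 4 L (Matrix.unitaryGroup (Fin 3) ℂ) =>
      (wilsonDirac (unitaryFundamentalRep (Fin 3) ℂ)
        (fun e => if (e.1 e.2).val + 1 = L then -W e else W e) m 1).det) =
      fun W => (wilsonDirac (unitaryFundamentalRep (Fin 3) ℂ)
        (apTwistAt (fun _ => (-1 : ZMod L)) W) m 1).det := by
    funext W
    rw [seam_eq_apTwistAt]
  have hq := hQC 3 L hEv h4 V m hm
  rw [key] at hq
  exact hq

/-! ## The stub -/

/-- Stub `stub_transferEven`: `TilingStability → QuarkChessboard → WilsonQuarkStabilityEven`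
(the lead's two propositions unfolded; `QuarkChessboard` the tree declaration of route
WilsonQuarkChessboard, item stmt-QuantumFields-9306, entering only as a hypothesis). -/
theorem stub_transferEven :
    (∃ ε C : ℝ, 0 < ε ∧ 0 ≤ C ∧ ∃ L₀ : ℕ, ∀ (L : ℕ) [NeZero L], L₀ ≤ L → Even L → ∀ m : ℝ, |m| ≤ ε →
      ∀ (V : GaugeConfig 4 L (Matrix.unitaryGroup (Fin 3) ℂ)) (c : Site 4 L),
        ‖(wilsonDirac (unitaryFundamentalRep (Fin 3) ℂ)
            (apTwistAt (fun _ => (-1 : ZMod L))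
              (fun e => if (e.1 e.2 - c e.2).val % 2 = 0
                then V (fun ν => c ν + (((e.1 ν - c ν).val % 2 : ℕ) : ZMod L), e.2)
                else (V (fun ν => c ν + (((Site.shift e.1 e.2 ν - c ν).val % 2 : ℕ) : ZMod L), e.2))⁻¹))
            m 1).det‖ ≤
          Real.exp (C * (L : ℝ) ^ 4 * ∑ p ∈ Finset.univ.filter (fun p : Plaquette 4 L =>
              (∀ ν, (p.1 ν - c ν).val ≤ 1) ∧ (p.1 p.2.1.1 - c p.2.1.1).val = 0 ∧
                (p.1 p.2.1.2 - c p.2.1.2).val = 0),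
            (3 - (((plaquetteHolonomy V p.1 p.2.1.1 p.2.1.2 : Matrix.unitaryGroup (Fin 3) ℂ) :
              Matrix (Fin 3) (Fin 3) ℂ)).trace.re)) *
            ‖(wilsonDirac (unitaryFundamentalRep (Fin 3) ℂ)
                (apTwistAt (fun _ => (-1 : ZMod L)) (1 : GaugeConfig 4 L (Matrix.unitaryGroup (Fin 3) ℂ)))
                m 1).det‖) →
    Summit.QuantumFields.QCD.Theses.WilsonQuarkChessboard.QuarkChessboard →
    (∃ ε δ K c₂ C : ℝ, 0 < ε ∧ 0 < δ ∧ ∃ L₀ : ℕ, ∀ (L : ℕ) [NeZero L], L₀ ≤ L → Even L → let apDet : Literature.MathematicalPhysics.QuantumFieldTheory.GaugeConfig 4 L (Matrix.specialUnitaryGroup (Fin 3) ℂ) → ℝ → ℂ := fun U m => Literature.MathematicalPhysics.QuantumLattice.fermionDet (Literature.MathematicalPhysics.QuantumLattice.wilsonDirac (Literature.MathematicalPhysics.QuantumLattice.unitaryFundamentalRep (Fin 3) ℂ) (fun e => if e.1 e.2 = -1 then -(⟨(U e).1, Matrix.specialUnitaryGroup_le_unitaryGroup (U e).2⟩ : Matrix.unitaryGroup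 (Fin 3) ℂ) else ⟨(U e).1, Matrix.specialUnitaryGroup_le_unitaryGroup (U e).2⟩) m 1); let dfc : Literature.MathematicalPhysics.QuantumFieldTheory.GaugeConfig 4 L (Matrix.specialUnitaryGroup (Fin 3) ℂ) → Literature.MathematicalPhysics.QuantumFieldTheory.Plaquette 4 L → ℝ := fun U p => 3 - (Literature.MathematicalPhysics.QuantumLattice.fundamentalRep (Fin 3) (Literature.MathematicalPhysics.QuantumFieldTheory.plaquetteHolonomy U p.1 p.2.1.1 p.2.1.2)).trace.re; ∀ m : ℝ, |m| ≤ ε → ∀ U : Literature.MathematicalPhysics.QuantumFieldTheory.GaugeConfig 4 L (Matrix.specialUnitaryGroup (Fin 3) ℂ), ‖apDet U m‖ ≤ Real.exp (K + c₂ * (∑ p ∈ Finset.univ.filter (fun p => dfc U p < δ), dfc U p) + C * ((Finset.univ.filter (fun p => δ ≤ dfc U p)).card : ℝ)) * ‖apDet 1 m‖) := by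
  rintro ⟨ε, C, hε, hC, L₀, hT⟩ hQC
  refine ⟨min ε (1 / 2), 1, 0, 16 * C, 96 * C, lt_min hε one_half_pos, one_pos, max L₀ 4, ?_⟩
  intro L _ hL hEv apDet dfc m hm U
  obtain ⟨hL₀, h4⟩ := max_le_iff.1 hL
  have hmε : |m| ≤ ε := hm.trans (min_le_left _ _)
  have hm1 : -1 < m := by
    have h := (abs_le.1 (hm.trans (min_le_right _ _))).1
    linarith
  -- (a) the chessboard for the lifted `U(3)` field, tree seam convention
  obtain ⟨hcell, hpow⟩ := qc_apTwistAt hQC hEv h4 (unitaryLift U) hm1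
  -- (d) combination with tiling stability, `L⁴`-th roots
  have hcard : Fintype.card (Site 4 L) = L ^ 4 := by
    simp only [Fintype.card_pi, ZMod.card, Finset.prod_const, Finset.card_univ, Fintype.card_fin]
  have hmain := combine hcard (pow_ne_zero 4 (NeZero.ne L)) (Nat.cast_pow L 4) (norm_nonneg _)
    (fun c => (hcell c).1) hpow (fun c => hT L hL₀ hEv m hmε (unitaryLift U) c)
  -- (b) the crux's determinants are those of the lifts
  have e1 : apDet U m = (wilsonDirac (unitaryFundamentalRep (Fin 3) ℂ)
      (apTwistAt (fun _ => (-1 : ZMod L)) (unitaryLift U)) m 1).det := rfl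
  have e2 : apDet 1 m = (wilsonDirac (unitaryFundamentalRep (Fin 3) ℂ)
      (apTwistAt (fun _ => (-1 : ZMod L)) (1 : GaugeConfig 4 L (Matrix.unitaryGroup (Fin 3) ℂ)))
        m 1).det := by
    rw [← unitaryLift_one]
    rfl
  rw [e1, e2]
  refine hmain.trans (mul_le_mul_of_nonneg_right (Real.exp_le_exp.2 ?_) (norm_nonneg _))
  -- (c), (e), (f) exponent bookkeeping
  have hdef : ∀ p : Plaquette 4 L,
      (3 - (((plaquetteHolonomy (unitaryLift U) p.1 p.2.1.1 p.2.1.2 : Matrix.unitaryGroup (Fin 3) ℂ) :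
        Matrix (Fin 3) (Fin 3) ℂ)).trace.re) = dfc U p := by
    intro p
    rw [coe_plaquetteHolonomy_unitaryLift]
  have h0 : ∀ p, 0 ≤ dfc U p := fun p => (deficit_bounds U p).1
  have h6 : ∀ p, dfc U p ≤ 6 := fun p => (deficit_bounds U p).2
  calc C * ∑ c : Site 4 L, ∑ p ∈ Finset.univ.filter (fun p : Plaquette 4 L =>
          (∀ ν, (p.1 ν - c ν).val ≤ 1) ∧ (p.1 p.2.1.1 - c p.2.1.1).val = 0 ∧
            (p.1 p.2.1.2 - c p.2.1.2).val = 0),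
          (3 - (((plaquetteHolonomy (unitaryLift U) p.1 p.2.1.1 p.2.1.2 :
            Matrix.unitaryGroup (Fin 3) ℂ) : Matrix (Fin 3) (Fin 3) ℂ)).trace.re)
      = C * ∑ c : Site 4 L, ∑ p ∈ Finset.univ.filter (fun p : Plaquette 4 L =>
          (∀ ν, (p.1 ν - c ν).val ≤ 1) ∧ (p.1 p.2.1.1 - c p.2.1.1).val = 0 ∧
            (p.1 p.2.1.2 - c p.2.1.2).val = 0), dfc U p := by
        simp only [hdef]
    _ ≤ C * (16 * ∑ p, dfc U p) := mul_le_mul_of_nonneg_left (sum_cells_le _ h0) hC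
    _ ≤ 0 + 16 * C * (∑ p ∈ Finset.univ.filter (fun p => dfc U p < 1), dfc U p) +
          96 * C * ((Finset.univ.filter fun p => 1 ≤ dfc U p).card : ℝ) := split_le _ _ h0 h6 hC

end

end Summit.QuantumFields.QCD.Cruxes.WilsonQuarkStability.FreeTangentLandauChessboard
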